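import Mathlib
import Summits.Langlands.Langlands.Theses.ParityLadder

/-! # ParityLadder — proof of the glue item of the split of `PrimitiveOddAutomorphy` (stmt-Langlands-29265) into
`GenericSurfaceAutomorphy ∧ ExceptionalSurfaceAutomorphy ∧ NonSurfaceOddAutomorphy` (lens-5-g6 node `AbelianSurfaceSwitchSplit`).
Pure logic: excluded middle on the two nested ∃-dials («has a totally real abelian-surface witness» ⊇ «has a switch-generic rational one»), written by
`by_contra` so that the dials are NEVER restated (robust to the gate's rendering).  To land as
`Summits/Langlands/Langlands/Theorems/ParityLadderPrimitiveOddAutomorphyOfSplit.lean` once the edit has created the glue item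
`ParityLadder.PrimitiveOddAutomorphy_of_split : Prop := NonSurfaceOddAutomorphy → ExceptionalSurfaceAutomorphy → GenericSurfaceAutomorphy →
PrimitiveOddAutomorphy` (stmt-Langlands-31531; the gate rendered the children in filing order NAS, ASX, ASG — route
ParityLadder rev 2, commit f9b57455a428 — so the binders are introduced in that order; proof text otherwise the node's). -/

set_option linter.dupNamespace false -- project-wide option; `Summit.Langlands.Langlands` is the mandated namespace

namespace Summit.Langlands.Langlands.Theorems

open Summit.Langlands.Langlands.Theses

/-- NAS → ASX → ASG → PO (glue item stmt-Langlands-31531 of route ParityLadder rev 2): excluded middle on the two nested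
inlined ∃-dials, by `by_contra`, dials never restated. -/
theorem PrimitiveOddAutomorphy_of_split_proof : ParityLadder.PrimitiveOddAutomorphy_of_split := by
  intro hN hE hG K _ _ n hcpt hn ℓ _ ι ρ hirr hgeo htw hee
  by_contra hno
  refine hno (hN K n hcpt hn ℓ ι ρ hirr hgeo htw hee fun hw => ?_)
  refine hno (hE K n hcpt hn ℓ ι ρ hirr hgeo htw hee ⟨hw, fun hg => ?_⟩)
  exact hno (hG K n hcpt hn ℓ ι ρ hirr hgeo htw hee hg)

end Summit.Langlands.Langlands.Theorems
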